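import Summits.QuantumFields.YangMills.Theses.FixedTorusFirst

/-!
# Assembly of route `FixedTorusFirst` (rung R2a of LADDER-YM, leaf `BalabanLadder.NT`; item stmt-QuantumFields-27356)

`SomeTorusFloors → FiniteSizeInsensitivity → NT`: the ε/2 transport of the planner's sketch (ym-idea-8 g3).  Given the floor
`ε ≤ Q2_{L₀}` on SOME comparison torus `L₀` of physical side `≥ max Λ₁ Λ₆` (first hypothesis) and the torus-size Cauchy property
`|Q2_L − Q2_{L₀}| ≤ ε/2` beyond `(β₆, Λ₆)` (second hypothesis, applied with `η = ε/2`), every torus `L` with `a(β)L ≥ max Λ₁ Λ₆` and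
`β ≥ max β₅ β₆` carries the floor `ε/2 ≤ Q2_L`; the three-point clause is identical with the reverse triangle inequality
`|Q3_{L₀}| − |Q3_L| ≤ |Q3_{L₀} − Q3_L|`.  Pure logic plus `max`/`linarith`.  No summit and no Clay statement is proved here; the rung
`NT` (a RECORD rung) stays open behind the route's two open cruxes (stmt-QuantumFields-27354, 27355).
-/

namespace Summit.QuantumFields.YangMills.Theorems

open Summit.QuantumFields.YangMills.Theses.FixedTorusFirst in
/-- The `Assembly` item of route `FixedTorusFirst`: some-torus floors at fixed physical size plus finite-size insensitivity at the
unit scale give the uniform lattice floors `NT` (with `ε/2`).  Uniform-from-pointwise-plus-modulus; nothing about the mass gap is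
proved by this. -/
theorem fixedTorusFirst_assembly : Summit.QuantumFields.YangMills.Theses.FixedTorusFirst.Assembly := by
  intro h1 h2 G _ _ _ _ hG
  obtain ⟨r, a, ha, hat, ⟨v, ε, Λ₁, hvs, hvc, hε, hfloor⟩,
    ⟨f, g, h, ε', Λ₁', hfc, hgc, hhc, dfg, dgh, dfh, hε', hfloor'⟩⟩ := h1 G hG
  obtain ⟨h2a, h2b⟩ := h2 G hG r a ha hat
  refine ⟨r, a, ha, hat, ?_, ?_⟩
  · -- two-point floor on every large torus
    obtain ⟨β₆, Λ₆, hC⟩ := h2a v hvs hvc (ε / 2) (half_pos hε)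
    obtain ⟨β₅, h5⟩ := hfloor (max Λ₁ Λ₆) (le_max_left _ _)
    refine ⟨v, ε / 2, max β₅ β₆, max Λ₁ Λ₆, hvs, half_pos hε, fun β hβ L hL => ?_⟩
    obtain ⟨L₀, hL₀, hεL₀⟩ := h5 β ((le_max_left _ _).trans hβ)
    have hc := hC β ((le_max_right _ _).trans hβ) L L₀ ((le_max_right _ _).trans hL)
      ((le_max_right _ _).trans hL₀)
    rw [abs_le] at hc
    linarith [hc.1, hc.2]
  · -- three-point floor on every large torus
    obtain ⟨β₆, Λ₆, hC⟩ := h2b f g h hfc hgc hhc dfg dgh dfh (ε' / 2) (half_pos hε')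
    obtain ⟨β₅, h5⟩ := hfloor' (max Λ₁' Λ₆) (le_max_left _ _)
    refine ⟨f, g, h, ε' / 2, max β₅ β₆, max Λ₁' Λ₆, dfg, dgh, dfh, half_pos hε', fun β hβ L hL => ?_⟩
    obtain ⟨L₀, hL₀, hεL₀⟩ := h5 β ((le_max_left _ _).trans hβ)
    have hc := hC β ((le_max_right _ _).trans hβ) L L₀ ((le_max_right _ _).trans hL)
      ((le_max_right _ _).trans hL₀)
    have key : ∀ x y : ℝ, ε' ≤ |y| → |x - y| ≤ ε' / 2 → ε' / 2 ≤ |x| := by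
      intro x y hy hxy
      have hrev := abs_sub_abs_le_abs_sub y x
      rw [abs_sub_comm] at hrev
      linarith
    exact key _ _ hεL₀ hc
end Summit.QuantumFields.YangMills.Theorems
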